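import Summits.AtomisticToContinuum.FouriersLaw.Theorems.OddSectorIrreversibilityTapLeakBoundBlockConeMaximal

/-!
# `TapLeakBound` (stmt-AtomisticToContinuum-15159), line `SketchIdeator2`, floor of `stub_kickCone`: higher-moment budget tail

Helper file (`--supports stmt-AtomisticToContinuum-15159`) for crux
P = `Summit.AtomisticToContinuum.FouriersLaw.Theses.OddSectorIrreversibility.TapLeakBound`, registered stub `stub_kickCone`
(floor program, sub-stub `stub_floorBudgetTail`). It is the higher-moment version of the second-moment maximal inequality
`measureReal_budget_gt_le` of `…TapLeakBoundBlockConeMaximal.lean`, for the energy BUDGET of a site along the closed flow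
`Φ_t = detFlow` of the pinned chain in the Gibbs weight `μ_T = gibbsWeight` (which `Φ_t` preserves — Liouville):

* `pow_succ_setIntegral_Ioc_le` — Jensen in time: `(∫_{(0,τ]} F)^{j+1} ≤ τ^j ∫_{(0,τ]} F^{j+1}` for continuous `F ≥ 0`;
* `add_pow_succ_le_two_pow_mul` — `(a+b)^{j+1} ≤ 2^j (a^{j+1} + b^{j+1})` for `a, b ≥ 0`;
* `integral_setIntegral_comp_detFlow` — Tonelli + invariance: for continuous `F ∈ L¹(μ_T)`,
  `x ↦ ∫_{(0,τ]} F(Φ_t x) dt` is `μ_T`-integrable with integral `τ ∫ F dμ_T`;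
* `measureReal_budget_gt_le_pow` — **the maximal inequality with moments `m, k ≥ 1`**: for `h ≥ 0` with `h^m ∈ L¹(μ_T)`,
  `f, g` continuous with `|f|^k, |g|^k ∈ L¹(μ_T)`, `τ ≥ 0`, `E > 0`,
  `μ_T{x : E < h(x) + ∫_{(0,τ]}(|f(Φ_t x)| + |g(Φ_t x)|) dt} ≤ (2/E)^m ∫ h^m dμ_T + ((4τ/E)^k / 2)(∫|f|^k dμ_T + ∫|g|^k dμ_T)`
  (inclusion `{E < h + I} ⊆ {E/2 ≤ h} ∪ {E/2 ≤ I}`, Markov with the `m`-th power on `h` and the `k`-th power on the time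
  integral `I`, `I^k ≤ (2τ)^{k-1} ∫_{(0,τ]} (|f|^k + |g|^k)∘Φ_t`, Tonelli and invariance);
* `stub_floorBudgetTail` — the registered closed `∀`-form.

References: folklore (Markov, Jensen, Tonelli, Liouville). Nothing here closes the item.
-/

noncomputable section

open MeasureTheory Filter Topology Set Function Metric
open scoped NNReal ENNReal

namespace Summit.AtomisticToContinuum.FouriersLaw.Theorems.OddSectorIrreversibility.TapLeak

open Literature.MathematicalPhysics.KineticTheory.HeatConduction
open Literature.MathematicalPhysics.KineticTheory
open Summit.AtomisticToContinuum.FouriersLaw.Theorems.ClosedConeSensitivity.Negative.ZeroFrictionDictionary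
open Summit.AtomisticToContinuum.FouriersLaw.Theorems.OddSectorIrreversibility.Corrector
open Summit.AtomisticToContinuum.FouriersLaw.Theorems.OddSectorWitness
open Summit.AtomisticToContinuum.FouriersLaw.Theorems.SubBallisticWindow.CoboundaryCeiling

/-! ### §12 Two elementary power inequalities -/

section Elementary

/-- **Jensen in time** (power mean on the window `(0, τ]`): for continuous `F ≥ 0` and `τ ≥ 0`,
`(∫_{(0,τ]} F)^{j+1} ≤ τ^j ∫_{(0,τ]} F^{j+1}` (Jensen for the probability measure `τ⁻¹ dt` on `(0,τ]` and the
convex `y ↦ y^{j+1}` on `[0, ∞)`; trivial for `τ = 0`). [folklore] -/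
theorem pow_succ_setIntegral_Ioc_le {F : ℝ → ℝ} {τ : ℝ} (hτ : 0 ≤ τ) (hF : Continuous F) (hF0 : ∀ t, 0 ≤ F t)
    (j : ℕ) :
    (∫ t in Ioc (0 : ℝ) τ, F t) ^ (j + 1) ≤ τ ^ j * ∫ t in Ioc (0 : ℝ) τ, F t ^ (j + 1) := by
  rcases hτ.eq_or_lt with rfl | hτ0
  · simp
  · have h0 : volume (Ioc (0 : ℝ) τ) ≠ 0 := by
      rw [Real.volume_Ioc, sub_zero]; exact (ENNReal.ofReal_pos.2 hτ0).ne'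
    have htop : volume (Ioc (0 : ℝ) τ) ≠ ∞ := measure_Ioc_lt_top.ne
    have hJ := (convexOn_pow (j + 1)).map_set_average_le (continuousOn_pow (j + 1)) isClosed_Ici h0 htop
      (Eventually.of_forall fun t => Set.mem_Ici.2 (hF0 t)) hF.integrableOn_Ioc
      ((hF.pow (j + 1)).integrableOn_Ioc)
    rw [setAverage_eq, setAverage_eq, Real.volume_real_Ioc_of_le hτ0.le, sub_zero] at hJ
    simp only [smul_eq_mul] at hJ
    rw [mul_pow, inv_pow, inv_mul_le_iff₀ (pow_pos hτ0 _)] at hJ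
    calc (∫ t in Ioc (0 : ℝ) τ, F t) ^ (j + 1) ≤ τ ^ (j + 1) * (τ⁻¹ * ∫ t in Ioc (0 : ℝ) τ, F t ^ (j + 1)) := hJ
      _ = τ ^ j * ∫ t in Ioc (0 : ℝ) τ, F t ^ (j + 1) := by
          rw [pow_succ, mul_assoc, mul_inv_cancel_left₀ hτ0.ne']

/-- `(a + b)^{j+1} ≤ 2^j (a^{j+1} + b^{j+1})` for `a, b ≥ 0` (convexity of `y ↦ y^{j+1}` at the midpoint). [folklore] -/
theorem add_pow_succ_le_two_pow_mul {a b : ℝ} (ha : 0 ≤ a) (hb : 0 ≤ b) (j : ℕ) :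
    (a + b) ^ (j + 1) ≤ 2 ^ j * (a ^ (j + 1) + b ^ (j + 1)) := by
  have h := (convexOn_pow (j + 1)).2 (Set.mem_Ici.2 ha) (Set.mem_Ici.2 hb) (by norm_num : (0 : ℝ) ≤ 1 / 2)
    (by norm_num : (0 : ℝ) ≤ 1 / 2) (by norm_num)
  simp only [smul_eq_mul] at h
  have h2 : (a + b) ^ (j + 1) = 2 ^ (j + 1) * (1 / 2 * a + 1 / 2 * b) ^ (j + 1) := by
    rw [← mul_pow]; congr 1; ring
  rw [h2, pow_succ, mul_assoc]
  exact mul_le_mul_of_nonneg_left (by linarith) (pow_nonneg (by norm_num) j)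

end Elementary

/-! ### §13 Tonelli + Liouville for a transported integrable observable -/

section Budget

variable {ω₂ lam β : ℝ} (hω : 0 < ω₂) (hl : 0 ≤ lam) (hβ : 0 ≤ β) (γ : ℝ) (N : ℕ) {T : ℝ}
include hω hl hβ

/-- For a continuous `F ∈ L¹(μ_T)` and `τ ≥ 0`: `x ↦ ∫_{(0,τ]} F(Φ_t x) dt` is `μ_T`-integrable and
`∫ ∫_{(0,τ]} F(Φ_t x) dt dμ_T = τ ∫ F dμ_T` (Tonelli, and invariance of `μ_T` under `Φ_t` at each `t ∈ (0, τ]`). [folklore] -/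
theorem integral_setIntegral_comp_detFlow (hT : 0 < T) {τ : ℝ} (hτ : 0 ≤ τ)
    {F : PhaseSpace N → ℝ} (hFc : Continuous F) (hFi : Integrable F (gibbsWeight ω₂ lam β γ N T)) :
    Integrable (fun x => ∫ t in Ioc (0 : ℝ) τ, F (detFlow ω₂ lam β N t x)) (gibbsWeight ω₂ lam β γ N T) ∧
    ∫ x, (∫ t in Ioc (0 : ℝ) τ, F (detFlow ω₂ lam β N t x)) ∂(gibbsWeight ω₂ lam β γ N T) =
      τ * ∫ x, F x ∂(gibbsWeight ω₂ lam β γ N T) := by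
  haveI := isFiniteMeasure_gibbsWeight hω hl hβ γ N hT
  have hFm : Measurable fun p : ℝ × PhaseSpace N => F (detFlow ω₂ lam β N p.1 p.2) :=
    hFc.measurable.comp (measurable_detFlow_uncurry hω hl hβ N)
  have hslice : ∀ t : ℝ, 0 ≤ t →
      Integrable (fun x => F (detFlow ω₂ lam β N t x)) (gibbsWeight ω₂ lam β γ N T) ∧
      ∫ x, F (detFlow ω₂ lam β N t x) ∂(gibbsWeight ω₂ lam β γ N T) = ∫ x, F x ∂(gibbsWeight ω₂ lam β γ N T) ∧
      ∫ x, ‖F (detFlow ω₂ lam β N t x)‖ ∂(gibbsWeight ω₂ lam β γ N T) =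
        ∫ x, ‖F x‖ ∂(gibbsWeight ω₂ lam β γ N T) := fun t ht =>
    ⟨integrable_comp_detFlow_gibbsWeight hω hl hβ γ N T ht hFi,
      integral_comp_detFlow_gibbsWeight hω hl hβ γ N T ht hFi.aestronglyMeasurable,
      integral_comp_detFlow_gibbsWeight hω hl hβ γ N T ht (g := fun x => ‖F x‖) hFi.aestronglyMeasurable.norm⟩
  have hInt : Integrable (fun p : ℝ × PhaseSpace N => F (detFlow ω₂ lam β N p.1 p.2))
      ((volume.restrict (Ioc (0 : ℝ) τ)).prod (gibbsWeight ω₂ lam β γ N T)) := by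
    rw [integrable_prod_iff hFm.aestronglyMeasurable]
    refine ⟨(ae_restrict_iff' measurableSet_Ioc).2 (Eventually.of_forall fun t ht => (hslice t ht.1.le).1), ?_⟩
    have hae : (fun t => ∫ x, ‖F (detFlow ω₂ lam β N t x)‖ ∂(gibbsWeight ω₂ lam β γ N T))
        =ᵐ[volume.restrict (Ioc (0 : ℝ) τ)] fun _ => ∫ x, ‖F x‖ ∂(gibbsWeight ω₂ lam β γ N T) :=
      (ae_restrict_iff' measurableSet_Ioc).2 (Eventually.of_forall fun t ht => (hslice t ht.1.le).2.2)
    exact (integrable_const _).congr hae.symm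
  refine ⟨hInt.integral_prod_right, ?_⟩
  rw [← integral_integral_swap (f := fun t x => F (detFlow ω₂ lam β N t x)) hInt,
    setIntegral_congr_fun measurableSet_Ioc (fun t ht => (hslice t ht.1.le).2.1), setIntegral_const,
    Real.volume_real_Ioc_of_le hτ, sub_zero, smul_eq_mul]

/-! ### §14 The higher-moment maximal inequality -/

/-- **THE MAXIMAL INEQUALITY (moments `m`, `k ≥ 1`), uniformly in `N`.** For `h ≥ 0` with `h^m ∈ L¹(μ_T)`, `f, g`
continuous with `|f|^k, |g|^k ∈ L¹(μ_T)`, `τ ≥ 0` and `E > 0`: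
`μ_T{x : E < h(x) + ∫_{(0,τ]}(|f(Φ_t x)| + |g(Φ_t x)|) dt} ≤ (2/E)^m ∫ h^m dμ_T + ((4τ/E)^k/2)(∫|f|^k dμ_T + ∫|g|^k dμ_T)`
(Markov with powers; Jensen in time, `(a+b)^k ≤ 2^{k-1}(a^k+b^k)`, Tonelli and Liouville for the time integral). [folklore] -/
theorem measureReal_budget_gt_le_pow (hT : 0 < T) {h f g : PhaseSpace N → ℝ} {m k : ℕ} (hk : 1 ≤ k)
    (hh0 : ∀ x, 0 ≤ h x) (hf : Continuous f) (hg : Continuous g)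
    (hhm : Integrable (fun x => h x ^ m) (gibbsWeight ω₂ lam β γ N T))
    (hfk : Integrable (fun x => |f x| ^ k) (gibbsWeight ω₂ lam β γ N T))
    (hgk : Integrable (fun x => |g x| ^ k) (gibbsWeight ω₂ lam β γ N T))
    {τ E : ℝ} (hτ : 0 ≤ τ) (hE : 0 < E) :
    (gibbsWeight ω₂ lam β γ N T).real {x | E < h x +
        ∫ t in Ioc (0 : ℝ) τ, (|f (detFlow ω₂ lam β N t x)| + |g (detFlow ω₂ lam β N t x)|)} ≤
      (2 / E) ^ m * ∫ x, h x ^ m ∂(gibbsWeight ω₂ lam β γ N T) +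
        (4 * τ / E) ^ k / 2 * ((∫ x, |f x| ^ k ∂(gibbsWeight ω₂ lam β γ N T)) +
          ∫ x, |g x| ^ k ∂(gibbsWeight ω₂ lam β γ N T)) := by
  obtain ⟨j, rfl⟩ : ∃ j, k = j + 1 := ⟨k - 1, by omega⟩
  set μ := gibbsWeight ω₂ lam β γ N T
  haveI : IsFiniteMeasure μ := isFiniteMeasure_gibbsWeight hω hl hβ γ N hT
  set I : PhaseSpace N → ℝ := fun x =>
    ∫ t in Ioc (0 : ℝ) τ, (|f (detFlow ω₂ lam β N t x)| + |g (detFlow ω₂ lam β N t x)|)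
  have hI0 : ∀ x, 0 ≤ I x := fun x =>
    setIntegral_nonneg measurableSet_Ioc fun t _ => add_nonneg (abs_nonneg _) (abs_nonneg _)
  have hIsm : StronglyMeasurable I := budget_stronglyMeasurable hω hl hβ N hf hg τ
  -- Tonelli + Liouville for the transported `k`-th powers
  have hFGc : Continuous fun x => |f x| ^ (j + 1) + |g x| ^ (j + 1) := (hf.abs.pow _).add (hg.abs.pow _)
  obtain ⟨hW, hW_eq⟩ :
      Integrable (fun x => ∫ t in Ioc (0 : ℝ) τ,
        (|f (detFlow ω₂ lam β N t x)| ^ (j + 1) + |g (detFlow ω₂ lam β N t x)| ^ (j + 1))) μ ∧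
      ∫ x, (∫ t in Ioc (0 : ℝ) τ,
        (|f (detFlow ω₂ lam β N t x)| ^ (j + 1) + |g (detFlow ω₂ lam β N t x)| ^ (j + 1))) ∂μ =
        τ * ∫ x, (|f x| ^ (j + 1) + |g x| ^ (j + 1)) ∂μ :=
    integral_setIntegral_comp_detFlow hω hl hβ γ N hT hτ (F := fun x => |f x| ^ (j + 1) + |g x| ^ (j + 1))
      hFGc (hfk.add hgk)
  -- pointwise: `I^k ≤ 2^(k-1) τ^(k-1) ∫_{(0,τ]} (|f|^k + |g|^k)∘Φ_t`
  have hIk_le : ∀ x, I x ^ (j + 1) ≤ 2 ^ j * τ ^ j * ∫ t in Ioc (0 : ℝ) τ,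
      (|f (detFlow ω₂ lam β N t x)| ^ (j + 1) + |g (detFlow ω₂ lam β N t x)| ^ (j + 1)) := by
    intro x
    have hΦc : Continuous fun t => detFlow ω₂ lam β N t x := Corrector.continuous_detFlow_time hω hl hβ N x
    have hfc : Continuous fun t => |f (detFlow ω₂ lam β N t x)| := (hf.comp hΦc).abs
    have hgc : Continuous fun t => |g (detFlow ω₂ lam β N t x)| := (hg.comp hΦc).abs
    have h1 := pow_succ_setIntegral_Ioc_le hτ (hfc.add hgc) (fun t => add_nonneg (abs_nonneg _) (abs_nonneg _)) j
    have h2 : ∫ t in Ioc (0 : ℝ) τ, (|f (detFlow ω₂ lam β N t x)| + |g (detFlow ω₂ lam β N t x)|) ^ (j + 1) ≤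
        ∫ t in Ioc (0 : ℝ) τ,
          2 ^ j * (|f (detFlow ω₂ lam β N t x)| ^ (j + 1) + |g (detFlow ω₂ lam β N t x)| ^ (j + 1)) := by
      refine setIntegral_mono_on ((hfc.add hgc).pow _).integrableOn_Ioc
        (((hfc.pow _).add (hgc.pow _)).const_mul _).integrableOn_Ioc measurableSet_Ioc fun t _ => ?_
      exact add_pow_succ_le_two_pow_mul (abs_nonneg _) (abs_nonneg _) j
    rw [integral_const_mul] at h2
    calc I x ^ (j + 1) ≤ _ := h1
      _ ≤ τ ^ j * (2 ^ j * ∫ t in Ioc (0 : ℝ) τ,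
          (|f (detFlow ω₂ lam β N t x)| ^ (j + 1) + |g (detFlow ω₂ lam β N t x)| ^ (j + 1))) :=
          mul_le_mul_of_nonneg_left h2 (pow_nonneg hτ j)
      _ = _ := by ring
  have hIki : Integrable (fun x => I x ^ (j + 1)) μ := by
    refine Integrable.mono' (hW.const_mul (2 ^ j * τ ^ j)) ((hIsm.measurable.pow_const _).aestronglyMeasurable)
      (Eventually.of_forall fun x => ?_)
    rw [Real.norm_of_nonneg (pow_nonneg (hI0 x) _)]
    exact hIk_le x
  have hIk_int : ∫ x, I x ^ (j + 1) ∂μ ≤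
      2 ^ j * τ ^ j * (τ * ((∫ x, |f x| ^ (j + 1) ∂μ) + ∫ x, |g x| ^ (j + 1) ∂μ)) := by
    calc ∫ x, I x ^ (j + 1) ∂μ ≤ ∫ x, 2 ^ j * τ ^ j * (∫ t in Ioc (0 : ℝ) τ,
          (|f (detFlow ω₂ lam β N t x)| ^ (j + 1) + |g (detFlow ω₂ lam β N t x)| ^ (j + 1))) ∂μ :=
          integral_mono hIki (hW.const_mul _) hIk_le
      _ = _ := by rw [integral_const_mul, hW_eq, integral_add hfk hgk]
  -- inclusion `{E < h + I} ⊆ {(E/2)^m ≤ h^m} ∪ {(E/2)^k ≤ I^k}`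
  have hE2 : 0 < E / 2 := by positivity
  have hsub : {x | E < h x + I x} ⊆ {x | (E / 2) ^ m ≤ h x ^ m} ∪ {x | (E / 2) ^ (j + 1) ≤ I x ^ (j + 1)} := by
    intro x hx
    simp only [mem_setOf_eq, mem_union] at hx ⊢
    by_cases hhx : E / 2 ≤ h x
    · exact Or.inl (pow_le_pow_left₀ hE2.le hhx m)
    · refine Or.inr (pow_le_pow_left₀ hE2.le ?_ (j + 1))
      linarith [not_le.1 hhx]
  -- Markov with powers
  have hM1 : (E / 2) ^ m * μ.real {x | (E / 2) ^ m ≤ h x ^ m} ≤ ∫ x, h x ^ m ∂μ :=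
    mul_meas_ge_le_integral_of_nonneg (Eventually.of_forall fun x => pow_nonneg (hh0 x) m) hhm _
  have hM2 : (E / 2) ^ (j + 1) * μ.real {x | (E / 2) ^ (j + 1) ≤ I x ^ (j + 1)} ≤ ∫ x, I x ^ (j + 1) ∂μ :=
    mul_meas_ge_le_integral_of_nonneg (Eventually.of_forall fun x => pow_nonneg (hI0 x) _) hIki _
  have h22 : (2 / E) * (E / 2) = 1 := by
    rw [div_mul_div_comm, mul_comm (2 : ℝ) E]; exact div_self (by positivity)
  have hunit : ∀ n : ℕ, (2 / E) ^ n * (E / 2) ^ n = 1 := fun n => by rw [← mul_pow, h22, one_pow]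
  have h2E : (0 : ℝ) ≤ 2 / E := by positivity
  have hA : μ.real {x | (E / 2) ^ m ≤ h x ^ m} ≤ (2 / E) ^ m * ∫ x, h x ^ m ∂μ :=
    calc μ.real {x | (E / 2) ^ m ≤ h x ^ m}
          = (2 / E) ^ m * ((E / 2) ^ m * μ.real {x | (E / 2) ^ m ≤ h x ^ m}) := by
          rw [← mul_assoc, hunit, one_mul]
      _ ≤ (2 / E) ^ m * ∫ x, h x ^ m ∂μ := mul_le_mul_of_nonneg_left hM1 (pow_nonneg h2E m)
  have h4 : (4 * τ / E) ^ (j + 1) = (2 / E) ^ (j + 1) * (2 ^ (j + 1) * τ ^ (j + 1)) := by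
    rw [← mul_pow, ← mul_pow]; congr 1; ring
  have hB : μ.real {x | (E / 2) ^ (j + 1) ≤ I x ^ (j + 1)} ≤
      (4 * τ / E) ^ (j + 1) / 2 * ((∫ x, |f x| ^ (j + 1) ∂μ) + ∫ x, |g x| ^ (j + 1) ∂μ) :=
    calc μ.real {x | (E / 2) ^ (j + 1) ≤ I x ^ (j + 1)}
          = (2 / E) ^ (j + 1) * ((E / 2) ^ (j + 1) * μ.real {x | (E / 2) ^ (j + 1) ≤ I x ^ (j + 1)}) := by
          rw [← mul_assoc, hunit, one_mul]
      _ ≤ (2 / E) ^ (j + 1) * (2 ^ j * τ ^ j * (τ * ((∫ x, |f x| ^ (j + 1) ∂μ) + ∫ x, |g x| ^ (j + 1) ∂μ))) :=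
          mul_le_mul_of_nonneg_left (hM2.trans hIk_int) (pow_nonneg h2E _)
      _ = (4 * τ / E) ^ (j + 1) / 2 * ((∫ x, |f x| ^ (j + 1) ∂μ) + ∫ x, |g x| ^ (j + 1) ∂μ) := by
          rw [h4]; ring
  calc μ.real {x | E < h x + I x}
        ≤ μ.real ({x | (E / 2) ^ m ≤ h x ^ m} ∪ {x | (E / 2) ^ (j + 1) ≤ I x ^ (j + 1)}) :=
        measureReal_mono hsub (measure_ne_top μ _)
    _ ≤ μ.real {x | (E / 2) ^ m ≤ h x ^ m} + μ.real {x | (E / 2) ^ (j + 1) ≤ I x ^ (j + 1)} :=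
        measureReal_union_le _ _
    _ ≤ _ := add_le_add hA hB

end Budget

/-! ### Registered sub-stub of the floor program (closed form of `measureReal_budget_gt_le_pow`) -/

/-- **Sub-goal `stub_floorBudgetTail`** (registered on the crux item for this helper file; closed `∀`-form of
`measureReal_budget_gt_le_pow`): the `N`-uniform higher-moment maximal inequality for the energy budget of a site along
the closed flow (F2 of the floor of `stub_kickCone`). [folklore] -/
theorem stub_floorBudgetTail : ∀ (ω₂ lam β : ℝ), 0 < ω₂ → 0 ≤ lam → 0 ≤ β → ∀ (γ : ℝ) (N : ℕ) (T : ℝ), 0 < T → ∀ (h f g : PhaseSpace N → ℝ) (m k : ℕ), 1 ≤ m → 1 ≤ k → (∀ x, 0 ≤ h x) → Continuous h → Continuous f → Continuous g → MeasureTheory.Integrable (fun x => h x ^ m) (gibbsWeight ω₂ lam β γ N T) → MeasureTheory.Integrable (fun x => |f x| ^ k) (gibbsWeight ω₂ lam β γ N T) → MeasureTheory.Integrable (fun x => |g x| ^ k) (gibbsWeight ω₂ lam β γ N T) → ∀ (τ E : ℝ), 0 ≤ τ → 0 < E → (gibbsWeight ω₂ lam β γ N T).real {x | E < h x + ∫ t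 in Set.Ioc (0 : ℝ) τ, (|f (Summit.AtomisticToContinuum.FouriersLaw.Theorems.ClosedConeSensitivity.Negative.ZeroFrictionDictionary.detFlow ω₂ lam β N t x)| + |g (Summit.AtomisticToContinuum.FouriersLaw.Theorems.ClosedConeSensitivity.Negative.ZeroFrictionDictionary.detFlow ω₂ lam β N t x)|)} ≤ (2 / E) ^ m * ∫ x, h x ^ m ∂(gibbsWeight ω₂ lam β γ N T) + (4 * τ / E) ^ k / 2 * ((∫ x, |f x| ^ k ∂(gibbsWeight ω₂ lam β γ N T)) + ∫ x, |g x| ^ k ∂(gibbsWeight ω₂ lam β γ N T)) :=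
  fun _ _ _ hω hl hβ γ N _ hT _ _ _ _ _ _ hk hh0 _ hf hg hhm hfk hgk _ _ hτ hE =>
    measureReal_budget_gt_le_pow hω hl hβ γ N hT hk hh0 hf hg hhm hfk hgk hτ hE

end Summit.AtomisticToContinuum.FouriersLaw.Theorems.OddSectorIrreversibility.TapLeak

end
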